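import Summits.CriticalPhenomena.PercolationContinuityZ3.Theorems.PercNearOneGluingNoHeavyQuantFarEarAtObserverReach
import Summits.CriticalPhenomena.PercolationContinuityZ3.Theorems.PercNearOneGluingNoHeavyQuantFarBundleLaw
import HarnessLib

/-!
# QUANT lane R8, front "FAR beyond trees", layer one — A TWO-RELAY EAR AT THE OBSERVER, IIb: first-moment bounds and cell relations

builds on p205010 (kernel theorem, internal audit signed; external expert review pending)

Support file (`--supports stmt-CriticalPhenomena-4575`), seat `prim-quant-p1` (gen 26); memo
`run/shared/lean/prim/quant/prim-quant-p1-g26/FOR-LEAD-EAR-AT-OBSERVER.md` §2.  Standard axioms; no sorries; no definitions.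

Setting of `…QuantFarEarAtObserverReach`: observer `o`, relay `v` with pairs `s(o,v)`, `s(v,u)` only, second relay `u`; relay set `A ∋ u, v`,
`A' = A ∖ {u, v}`, `n' = |A'|`; off-`v` data `G = [o ~ u off v]`, `K₁ = #{a ∈ A ∖ v : o ~ a off v}`.  For ANY finite measure (no percolation
structure needed — these are integrated pointwise counting facts):
* `EarAtObserver.sum_real_le_of_pointwise` — a sum of probabilities bounded through a pointwise bound on the indicator sum;
* **`EarAtObserver.sum_real_reach_le`**: `Σ_{b∈A'} P(o ~ b off v) ≤ P(¬G, K₁ = 1) + n'·P(K₁ ≥ 2)`;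
* **`EarAtObserver.sum_real_feed_le`**: `Σ_{b∈A'} P(o ≁ b, u ~ b off v) ≤ n'·P(K₁ = 0) + (n'−1)·P(¬G, K₁ ≥ 1)`;
* `EarAtObserver.real_cells` — the linear relations among `P(K₁ = 0)`, `P(¬G, K₁ ≤ 1)`, `P(K₁ ≤ 1)`, `P(G)`, `P(¬G, K₁ = 1)`, `P(K₁ ≥ 2)`,
  `P(¬G, K₁ ≥ 1)` (using `G ⟹ K₁ ≥ 1`).
[this work]
-/

noncomputable section

namespace Summit.CriticalPhenomena.PercolationContinuityZ3.Theorems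

namespace Quant

namespace EarAtObserver

open Finset MeasureTheory Set
open Literature.Probability.LatticeModels
open Literature.Probability.Percolation
open Bundle (offZ avoid determinedBy_offZ mem_iff_of_inter_compl_eq reachable_of_offZ)
open scoped Classical

variable {n : ℕ} {o v u : Fin n}

/-! ## First-moment bounds and the cell relations (off `v`; no goodness needed) -/

/-- A sum of probabilities bounded through a pointwise bound on the sum of indicators by a combination of two indicators. [folklore] -/
theorem sum_real_le_of_pointwise (μ : Measure (BondConfig (Fin n))) [IsFiniteMeasure μ] {κ : Type*} (s : Finset κ)
    (E : κ → Set (BondConfig (Fin n))) (c₁ c₂ : ℝ) (S₁ S₂ : Set (BondConfig (Fin n)))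
    (h : ∀ ω, (∑ k ∈ s, (if ω ∈ E k then (1 : ℝ) else 0)) ≤
      c₁ * (if ω ∈ S₁ then (1 : ℝ) else 0) + c₂ * (if ω ∈ S₂ then (1 : ℝ) else 0)) :
    ∑ k ∈ s, μ.real (E k) ≤ c₁ * μ.real S₁ + c₂ * μ.real S₂ := by
  have hmeas : ∀ U : Set (BondConfig (Fin n)), MeasurableSet U := fun U => (Set.toFinite U).measurableSet
  have hint : ∀ k ∈ s, Integrable ((E k).indicator fun _ => (1 : ℝ)) μ :=
    fun k _ => (integrable_const (1 : ℝ)).indicator (hmeas _)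
  have h1 : ∀ k ∈ s, μ.real (E k) = ∫ ω, (E k).indicator (fun _ => (1 : ℝ)) ω ∂μ := by
    intro k _
    rw [integral_indicator_const _ (hmeas _), smul_eq_mul, mul_one]
  have hsum : ∑ k ∈ s, μ.real (E k) = ∫ ω, (∑ k ∈ s, (E k).indicator (fun _ => (1 : ℝ)) ω) ∂μ := by
    rw [Finset.sum_congr rfl h1, ← integral_finsetSum s hint]
  have hi1 : Integrable (fun ω => c₁ * S₁.indicator (fun _ => (1 : ℝ)) ω) μ :=
    ((integrable_const (1 : ℝ)).indicator (hmeas _)).const_mul c₁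
  have hi2 : Integrable (fun ω => c₂ * S₂.indicator (fun _ => (1 : ℝ)) ω) μ :=
    ((integrable_const (1 : ℝ)).indicator (hmeas _)).const_mul c₂
  have hS1 : c₁ * μ.real S₁ = ∫ ω, c₁ * S₁.indicator (fun _ => (1 : ℝ)) ω ∂μ := by
    rw [integral_const_mul, integral_indicator_const _ (hmeas _), smul_eq_mul, mul_one]
  have hS2 : c₂ * μ.real S₂ = ∫ ω, c₂ * S₂.indicator (fun _ => (1 : ℝ)) ω ∂μ := by
    rw [integral_const_mul, integral_indicator_const _ (hmeas _), smul_eq_mul, mul_one]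
  rw [hsum, hS1, hS2, ← integral_add hi1 hi2]
  refine integral_mono (integrable_finsetSum s hint) (hi1.add hi2) fun ω => ?_
  have e : ∀ (U : Set (BondConfig (Fin n))), U.indicator (fun _ => (1 : ℝ)) ω = if ω ∈ U then (1 : ℝ) else 0 :=
    fun U => Set.indicator_apply U (fun _ => (1 : ℝ)) ω
  simp only [e]
  exact h ω

/-- **First moment of the outside relays joined to `o` off `v`:**
`Σ_{b ∈ A'} P(o ~ b off v) ≤ P(¬ o ~ u off v, K₁ = 1) + |A'|·P(K₁ ≥ 2)`. [this work] -/
theorem sum_real_reach_le (μ : Measure (BondConfig (Fin n))) [IsFiniteMeasure μ] (huv : u ≠ v) {A : Finset (Fin n)} (huA : u ∈ A) :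
    ∑ b ∈ (A.erase v).erase u, μ.real {ω : BondConfig (Fin n) | offZ {v} ω ∈ openConn o b} ≤
      1 * μ.real {ω : BondConfig (Fin n) | ¬ (openGraph (offZ {v} ω)).Reachable o u ∧
          ((A.erase v).filter fun a => offZ {v} ω ∈ openConn o a).card = 1} +
        ((A.erase v).erase u).card *
          μ.real {ω : BondConfig (Fin n) | 2 ≤ ((A.erase v).filter fun a => offZ {v} ω ∈ openConn o a).card} := by
  refine sum_real_le_of_pointwise μ _ _ _ _ _ _ fun ω => ?_
  have h := sum_reach_le (o := o) (ω := ω) huv huA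
  simp only [Set.mem_setOf_eq, one_mul]
  convert h using 6

/-- **First moment of the feedback relays:** `Σ_{b ∈ A'} P(o ≁ b, u ~ b off v) ≤ |A'|·P(K₁ = 0) + (|A'| − 1)·P(¬ o ~ u off v, K₁ ≥ 1)`.
[this work] -/
theorem sum_real_feed_le (μ : Measure (BondConfig (Fin n))) [IsFiniteMeasure μ] (huv : u ≠ v) {A : Finset (Fin n)} (huA : u ∈ A) :
    ∑ b ∈ (A.erase v).erase u, μ.real {ω : BondConfig (Fin n) |
        ¬ (openGraph (offZ {v} ω)).Reachable o b ∧ (openGraph (offZ {v} ω)).Reachable u b} ≤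
      ((A.erase v).erase u).card *
          μ.real {ω : BondConfig (Fin n) | ((A.erase v).filter fun a => offZ {v} ω ∈ openConn o a).card = 0} +
        (((A.erase v).erase u).card - 1) *
          μ.real {ω : BondConfig (Fin n) | ¬ (openGraph (offZ {v} ω)).Reachable o u ∧
            1 ≤ ((A.erase v).filter fun a => offZ {v} ω ∈ openConn o a).card} := by
  refine sum_real_le_of_pointwise μ _ _ _ _ _ _ fun ω => ?_
  have h := sum_feed_le (o := o) (ω := ω) huv huA
  simp only [Set.mem_setOf_eq]
  convert h using 6

/-- **The cell relations.**  With `K₁ = #{a ∈ A ∖ v : o ~ a off v}`, `G = [o ~ u off v]` (so `G ⟹ K₁ ≥ 1` as `u ∈ A ∖ v`), for any finite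
measure: `P(¬G, K₁ = 1) + P(K₁ = 0) = P(¬G, K₁ ≤ 1)`, `P(K₁ ≥ 2) + P(K₁ ≤ 1) = P(univ)`, `P(¬G, K₁ ≥ 1) + P(K₁ = 0) + P(G) = P(univ)`,
`P(¬G, K₁ ≤ 1) ≤ P(K₁ ≤ 1) ≤ P(¬G, K₁ ≤ 1) + P(G)`, `P(¬G, K₁ ≤ 1) + P(G) ≤ P(univ)`. [this work] -/
theorem real_cells (μ : Measure (BondConfig (Fin n))) [IsFiniteMeasure μ] (huv : u ≠ v) {A : Finset (Fin n)} (huA : u ∈ A) :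
    μ.real {ω : BondConfig (Fin n) | ¬ (openGraph (offZ {v} ω)).Reachable o u ∧
          ((A.erase v).filter fun a => offZ {v} ω ∈ openConn o a).card = 1} +
        μ.real {ω : BondConfig (Fin n) | ((A.erase v).filter fun a => offZ {v} ω ∈ openConn o a).card = 0} =
      μ.real {ω : BondConfig (Fin n) | ¬ (openGraph (offZ {v} ω)).Reachable o u ∧
        ((A.erase v).filter fun a => offZ {v} ω ∈ openConn o a).card ≤ 1} ∧
    μ.real {ω : BondConfig (Fin n) | 2 ≤ ((A.erase v).filter fun a => offZ {v} ω ∈ openConn o a).card} +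
        μ.real {ω : BondConfig (Fin n) | ((A.erase v).filter fun a => offZ {v} ω ∈ openConn o a).card ≤ 1} = μ.real Set.univ ∧
    μ.real {ω : BondConfig (Fin n) | ¬ (openGraph (offZ {v} ω)).Reachable o u ∧
          1 ≤ ((A.erase v).filter fun a => offZ {v} ω ∈ openConn o a).card} +
        μ.real {ω : BondConfig (Fin n) | ((A.erase v).filter fun a => offZ {v} ω ∈ openConn o a).card = 0} +
        μ.real {ω : BondConfig (Fin n) | offZ {v} ω ∈ openConn o u} = μ.real Set.univ ∧
    μ.real {ω : BondConfig (Fin n) | ¬ (openGraph (offZ {v} ω)).Reachable o u ∧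
        ((A.erase v).filter fun a => offZ {v} ω ∈ openConn o a).card ≤ 1} ≤
      μ.real {ω : BondConfig (Fin n) | ((A.erase v).filter fun a => offZ {v} ω ∈ openConn o a).card ≤ 1} ∧
    μ.real {ω : BondConfig (Fin n) | ((A.erase v).filter fun a => offZ {v} ω ∈ openConn o a).card ≤ 1} ≤
      μ.real {ω : BondConfig (Fin n) | ¬ (openGraph (offZ {v} ω)).Reachable o u ∧
          ((A.erase v).filter fun a => offZ {v} ω ∈ openConn o a).card ≤ 1} +
        μ.real {ω : BondConfig (Fin n) | offZ {v} ω ∈ openConn o u} ∧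
    μ.real {ω : BondConfig (Fin n) | ¬ (openGraph (offZ {v} ω)).Reachable o u ∧
          ((A.erase v).filter fun a => offZ {v} ω ∈ openConn o a).card ≤ 1} +
        μ.real {ω : BondConfig (Fin n) | offZ {v} ω ∈ openConn o u} ≤ μ.real Set.univ := by
  have hmeas : ∀ U : Set (BondConfig (Fin n)), MeasurableSet U := fun U => (Set.toFinite U).measurableSet
  have huA' : u ∈ A.erase v := mem_erase.2 ⟨huv, huA⟩
  -- `G ⟹ K₁ ≥ 1`
  have hGK : ∀ ω : BondConfig (Fin n), (openGraph (offZ {v} ω)).Reachable o u →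
      1 ≤ ((A.erase v).filter fun a => offZ {v} ω ∈ openConn o a).card :=
    fun ω h => card_pos.2 ⟨u, mem_filter.2 ⟨huA', h⟩⟩
  set Gs := {ω : BondConfig (Fin n) | offZ {v} ω ∈ openConn o u} with hGs
  set X0 := {ω : BondConfig (Fin n) | ((A.erase v).filter fun a => offZ {v} ω ∈ openConn o a).card = 0} with hX0
  set X1 := {ω : BondConfig (Fin n) | ¬ (openGraph (offZ {v} ω)).Reachable o u ∧
    ((A.erase v).filter fun a => offZ {v} ω ∈ openConn o a).card ≤ 1} with hX1
  set X2 := {ω : BondConfig (Fin n) | ((A.erase v).filter fun a => offZ {v} ω ∈ openConn o a).card ≤ 1} with hX2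
  set Y := {ω : BondConfig (Fin n) | ¬ (openGraph (offZ {v} ω)).Reachable o u ∧
    ((A.erase v).filter fun a => offZ {v} ω ∈ openConn o a).card = 1} with hY
  set Zt := {ω : BondConfig (Fin n) | 2 ≤ ((A.erase v).filter fun a => offZ {v} ω ∈ openConn o a).card} with hZt
  set Zp := {ω : BondConfig (Fin n) | ¬ (openGraph (offZ {v} ω)).Reachable o u ∧
    1 ≤ ((A.erase v).filter fun a => offZ {v} ω ∈ openConn o a).card} with hZp
  refine ⟨?_, ?_, ?_, ?_, ?_, ?_⟩
  · -- `Y ∪ X0 = X1`, disjointly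
    have hU : Y ∪ X0 = X1 := by
      ext ω
      simp only [hY, hX0, hX1, Set.mem_union, Set.mem_setOf_eq]
      constructor
      · rintro (⟨h1, h2⟩ | h)
        · exact ⟨h1, by omega⟩
        · exact ⟨fun hG => by have := hGK ω hG; omega, by omega⟩
      · rintro ⟨h1, h2⟩
        by_cases h0 : ((A.erase v).filter fun a => offZ {v} ω ∈ openConn o a).card = 0
        · exact Or.inr h0
        · exact Or.inl ⟨h1, by omega⟩
    have hd : Disjoint Y X0 := by
      rw [Set.disjoint_left]
      rintro ω ⟨-, h1⟩ h0
      simp only [hX0, Set.mem_setOf_eq] at h0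
      omega
    rw [← hU, measureReal_union hd (hmeas _)]
  · have hU : Zt ∪ X2 = Set.univ := by
      ext ω
      simp only [hZt, hX2, Set.mem_union, Set.mem_setOf_eq, Set.mem_univ, iff_true]
      omega
    have hd : Disjoint Zt X2 := by
      rw [Set.disjoint_left]
      rintro ω h2 h1
      simp only [hZt, hX2, Set.mem_setOf_eq] at h2 h1
      omega
    rw [← hU, measureReal_union hd (hmeas _)]
  · have hU : Zp ∪ X0 ∪ Gs = Set.univ := by
      ext ω
      simp only [hZp, hX0, hGs, Set.mem_union, Set.mem_setOf_eq, Set.mem_univ, iff_true]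
      by_cases hG : (openGraph (offZ {v} ω)).Reachable o u
      · exact Or.inr hG
      · by_cases h0 : ((A.erase v).filter fun a => offZ {v} ω ∈ openConn o a).card = 0
        · exact Or.inl (Or.inr h0)
        · exact Or.inl (Or.inl ⟨hG, by omega⟩)
    have hd1 : Disjoint Zp X0 := by
      rw [Set.disjoint_left]
      rintro ω ⟨-, h1⟩ h0
      simp only [hX0, Set.mem_setOf_eq] at h0
      omega
    have hd2 : Disjoint (Zp ∪ X0) Gs := by
      rw [Set.disjoint_left]
      rintro ω (⟨h1, -⟩ | h0) hG
      · exact h1 hG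
      · simp only [hX0, Set.mem_setOf_eq] at h0
        have := hGK ω hG
        omega
    rw [← hU, measureReal_union hd2 (hmeas _), measureReal_union hd1 (hmeas _)]
  · exact measureReal_mono (fun ω hω => hω.2)
  · have hsub : X2 ⊆ X1 ∪ Gs := by
      intro ω hω
      simp only [hX2, hX1, hGs, Set.mem_union, Set.mem_setOf_eq] at hω ⊢
      by_cases hG : (openGraph (offZ {v} ω)).Reachable o u
      · exact Or.inr hG
      · exact Or.inl ⟨hG, hω⟩
    exact (measureReal_mono hsub).trans (measureReal_union_le X1 Gs)
  · have hd : Disjoint X1 Gs := by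
      rw [Set.disjoint_left]
      rintro ω ⟨h1, -⟩ hG
      exact h1 hG
    rw [← measureReal_union hd (hmeas _)]
    exact measureReal_mono (Set.subset_univ _)

end EarAtObserver

end Quant

end Summit.CriticalPhenomena.PercolationContinuityZ3.Theorems
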